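import Summits.PneNP.PneNP.Theorems.PseudorandomTwinsAbove.Negative.FalseWithoutPolyTime
import Summits.PneNP.PneNP.Theorems.PeaWorstToAvg.Negative.PeaWorstToAvgStrengthenings

/-!
# Route PhaseTwins, crux `PseudorandomTwinsAbove` (stmt-PneNP-2721) — negative side: the index-aware repair and the junk witness without positivity

Companion of `Negative/FalseWithoutPolyTime.lean` (crux stmt-PneNP-2721,
`Summit.PneNP.PneNP.Theses.PhaseTwins.PseudorandomTwinsAbove`), from the disprover's work file
`Summits/PneNP/PneNP/Cruxes/PseudorandomTwinsAbove/Disproof.lean`.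

* `pseudorandomTwinsAboveIndexed_false_without_polyTime`: route review (refuter 765f0ae2) proposed
  to repair clause (i) by feeding the index, `A.pr id (boolPair (unaryEncodeNat n) x) {true}`
  (Goldreich's convention). The load-bearing analysis is unchanged: with the time bound on the
  tests dropped the repaired statement is false too (`no_twins_against_unbounded_indexed_tests`;
  the deterministic test `z ↦ 1_S((boolUnpair z).2)` ignores the index).
* `twins_junk_without_positivity`: dropping the conjunct `0 < N x` from the `D₁`-event of clause
  (ii) makes the crux junk-true — `D₀ = D₁ = δ_{[0,1,1]}` (a string that does not decode to a
  graph, `decode_junk`; constant samplers are PPT, `isPolySamplable_const` from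
  `PeaWorstToAvg/Negative/PeaWorstToAvgStrengthenings.lean`) with threshold `t = 0`.
  Hence the positivity conjunct is exactly what excludes `D₀ = D₁`-type witnesses.

References: O. Goldreich, *Foundations of Cryptography I* (2001), Def. 3.2.2 (distinguishers receive
`1ⁿ`); A. Bogdanov, L. Trevisan, *Average-Case Complexity* (2006), Def. 2.1 (samplable ensembles).
[folklore]
-/

namespace Summit.PneNP.PneNP.Theorems.PseudorandomTwinsAbove.Negative

open Literature.Computability.Complexity Literature.Computability.MetaComplexity
open Filter Topology
open scoped ENNReal

noncomputable section

/-! ## The index-aware repair of clause (i), time bound dropped -/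

/-- Acceptance functional of the index-aware deterministic test `z ↦ 1_S((boolUnpair z).2)` run on
`boolPair (unaryEncodeNat n) x`: again the mass of `S`. [folklore] -/
theorem tsum_indexedIndicatorTest_eq_mass (D : PMF (List Bool)) (S : Set (List Bool))
    [DecidablePred (· ∈ S)] (n : ℕ) :
    ∑' x, (D x).toReal *
        (RandAlg.ofDet fun z => decide ((boolUnpair z).2 ∈ S)).pr id
          (boolPair (Computability.unaryEncodeNat n) x) {b | b = true}
      = (PMF.toOuterMeasure D S).toReal := by
  classical
  have hpr : ∀ x, (RandAlg.ofDet fun z => decide ((boolUnpair z).2 ∈ S)).pr id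
      (boolPair (Computability.unaryEncodeNat n) x) {b | b = true} = if x ∈ S then 1 else 0 := by
    intro x
    rw [RandAlg.pr_ofDet]
    by_cases hx : x ∈ S <;> simp [hx, boolUnpair_boolPair]
  simp_rw [hpr]
  rw [PMF.toOuterMeasure_apply, ENNReal.tsum_toReal_eq (fun x => ?_)]
  · refine tsum_congr fun x => ?_
    by_cases hx : x ∈ S
    · simp [hx]
    · simp [hx]
  · exact ((Set.indicator_le_self S D x).trans_lt (PMF.apply_lt_top D x)).ne

/-- Abstract form for INDEX-AWARE unbounded tests (the reviewers' repair `A.pr id (boolPair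
(unaryEncodeNat n) x) {true}` of clause (i), with the time bound dropped): contradictory as well —
the index does not help the twins, the set `S` ignores it. [this work] -/
theorem no_twins_against_unbounded_indexed_tests (N : List Bool → ℕ) (D₀ D₁ : Ensemble)
    (t : ℕ → ℕ)
    (hind : ∀ A : RandAlg (List Bool) Bool, Tendsto (fun n : ℕ =>
      |(∑' x : List Bool, ((D₀ n) x).toReal *
          A.pr id (boolPair (Computability.unaryEncodeNat n) x) {b | b = true}) -
        (∑' x : List Bool, ((D₁ n) x).toReal *
          A.pr id (boolPair (Computability.unaryEncodeNat n) x) {b | b = true})|) atTop (𝓝 0))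
    (h₀ : Tendsto (fun n : ℕ => D₀.prob n {x | 8 * t n ≤ N x}) atTop (𝓝 1))
    (h₁ : Tendsto (fun n : ℕ => D₁.prob n {x | 0 < N x ∧ N x ≤ t n}) atTop (𝓝 1)) : False := by
  classical
  refine no_setwise_indistinguishable_far_pair D₀ D₁ (fun n => {x | 8 * t n ≤ N x})
    (fun n => {x | 0 < N x ∧ N x ≤ t n}) ?_ h₀ h₁ ?_
  · intro n
    rw [Set.disjoint_left]
    rintro x (hx : 8 * t n ≤ N x) ⟨hpos, hle⟩
    omega
  · intro S
    have h' := hind (RandAlg.ofDet fun z => decide ((boolUnpair z).2 ∈ S))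
    simp only [tsum_indexedIndicatorTest_eq_mass] at h'
    exact h'

open scoped Classical in
/-- The reviewers' INDEX-AWARE repair of the crux (clause (i) with `A.pr id (boolPair
(unaryEncodeNat n) x) {true}`), with the time bound on the tests DROPPED, is false as well: the
witness set `S` of `no_setwise_indistinguishable_far_pair` ignores the index (work-file name:
`PseudorandomTwinsAboveIndexedWithoutPolyTime`). [this work] -/
theorem pseudorandomTwinsAboveIndexed_false_without_polyTime :
    ¬ (∃ Δ p q : ℕ, 3 ≤ Δ ∧ 0 < q ∧ ((Δ : ℝ) - 1) ^ (Δ - 1) / ((Δ : ℝ) - 2) ^ Δ < (p : ℝ) / q ∧ ∃ D₀ D₁ : Literature.Computability.MetaComplexity.Ensemble, D₀.IsPolySamplable ∧ D₁.IsPolySamplable ∧ (∀ A : Literature.Computability.Complexity.RandAlg (List Bool) Bool, Filter.Tendsto (fun n : ℕ => |(∑' x : List Bool, ((D₀ n) x).toReal * A.pr id (boolPair (Computability.unaryEncodeNat n) x) {b | b = true}) - (∑' x : List Bool, ((D₁ n) x).toReal * A.pr id (boolPair (Computability.unaryEncodeNat n) x) {b | b = true})|) Filter.atTop (nhds 0))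 ∧ ∃ t : ℕ → ℕ, Filter.Tendsto (fun n : ℕ => D₀.prob n {x | 8 * t n ≤ (match Literature.Computability.Complexity.encodingGraph.decode x with | none => 0 | some G => if G.2.maxDegree ≤ Δ then ∑ I : Finset (Fin G.1), (if G.2.IsIndepSet (↑I : Set (Fin G.1)) then p ^ I.card * q ^ (G.1 - I.card) else 0) else 0)}) Filter.atTop (nhds 1) ∧ Filter.Tendsto (fun n : ℕ => D₁.prob n {x | 0 < (match Literature.Computability.Complexity.encodingGraph.decode x with | none => 0 | some G => if G.2.maxDegree ≤ Δ then ∑ I : Finset (Fin G.1), (if G.2.IsIndepSet (↑I : Set (Fin G.1)) then p ^ I.card * q ^ (G.1 - I.card) else 0) else 0) ∧ (match Literature.Computability.Complexity.encodingGraph.decode x with | none => 0 | some G => if G.2.maxDegree ≤ Δ then ∑ I : Finset (Fin G.1), (if G.2.IsIndepSet (↑I : Set (Fin G.1)) then p ^ I.card * q ^ (G.1 - I.card) else 0) else 0) ≤ t n}) Filter.atTop (nhds 1)) := by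
  rintro ⟨Δ, p, q, -, -, -, D₀, D₁, -, -, hind, t, h₀, h₁⟩
  exact no_twins_against_unbounded_indexed_tests _ D₀ D₁ t hind h₀ h₁

/-! ## The positivity conjunct `0 < N x` is what excludes junk witnesses -/

/-- A junk string: `[0,1,1]` is `boolPair [] [1]`, i.e. vertex count `0` with a payload of
length `1 ≠ 0·0`, so `encodingGraph.decode` fails and the hard-core count is `0`. [folklore] -/
theorem decode_junk : encodingGraph.decode [false, true, true] = none := by
  rfl

open scoped Classical in
/-- WITHOUT THE POSITIVITY CONJUNCT `0 < N x` THE CRUX IS JUNK-TRUE. The statement below is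
the crux verbatim with `0 < N x` dropped from the `D₁`-event of clause (ii); witness `D₀ = D₁ =`
the point mass on the junk string `[0,1,1]` (hard-core count `0`, `decode_junk`), `t = 0`:
both events have probability `1` and identical ensembles fool every test. So `0 < N x` (i.e.
`D₁` lives on the promise) is the clause that forces the ensembles apart; a witness of the real
crux must put `D₁` on valid bounded-degree graph codes (work-file name:
`PseudorandomTwinsAboveWithoutPositivity`). [this work] -/
theorem twins_junk_without_positivity :
    ∃ Δ p q : ℕ, 3 ≤ Δ ∧ 0 < q ∧ ((Δ : ℝ) - 1) ^ (Δ - 1) / ((Δ : ℝ) - 2) ^ Δ < (p : ℝ) / q ∧ ∃ D₀ D₁ : Literature.Computability.MetaComplexity.Ensemble, D₀.IsPolySamplable ∧ D₁.IsPolySamplable ∧ (∀ A : Literature.Computability.Complexity.RandAlg (List Bool) Bool, A.IsPolyTime (id : List Bool → List Bool) Computability.encodeBool → Filter.Tendsto (fun n : ℕ => |(∑' x : List Bool, ((D₀ n) x).toReal * A.pr id x {b | b = true}) - (∑' x : List Bool, ((D₁ n) x).toReal * A.pr id x {b | b = true})|) Filter.atTop (nhds 0)) ∧ ∃ t : ℕ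 → ℕ, Filter.Tendsto (fun n : ℕ => D₀.prob n {x | 8 * t n ≤ (match Literature.Computability.Complexity.encodingGraph.decode x with | none => 0 | some G => if G.2.maxDegree ≤ Δ then ∑ I : Finset (Fin G.1), (if G.2.IsIndepSet (↑I : Set (Fin G.1)) then p ^ I.card * q ^ (G.1 - I.card) else 0) else 0)}) Filter.atTop (nhds 1) ∧ Filter.Tendsto (fun n : ℕ => D₁.prob n {x | (match Literature.Computability.Complexity.encodingGraph.decode x with | none => 0 | some G => if G.2.maxDegree ≤ Δ then ∑ I : Finset (Fin G.1), (if G.2.IsIndepSet (↑I : Set (Fin G.1)) then p ^ I.card * q ^ (G.1 - I.card) else 0) else 0) ≤ t n}) Filter.atTop (nhds 1) := by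
  classical
  refine ⟨3, 5, 1, le_rfl, Nat.one_pos, by norm_num, fun _ => PMF.pure [false, true, true],
    fun _ => PMF.pure [false, true, true], isPolySamplable_const _, isPolySamplable_const _,
    fun A _ => by simp, fun _ => 0, ?_, ?_⟩
  · refine tendsto_const_nhds.congr fun n => ?_
    simp only [Nat.mul_zero, Nat.zero_le, Set.setOf_true]
    simp [Ensemble.prob]
  · refine tendsto_const_nhds.congr fun n => ?_
    have hmem : [false, true, true] ∈ {x : List Bool | (match
        Literature.Computability.Complexity.encodingGraph.decode x with
        | none => 0
        | some G => if G.2.maxDegree ≤ 3 then ∑ I : Finset (Fin G.1),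
            (if G.2.IsIndepSet (↑I : Set (Fin G.1)) then 5 ^ I.card * 1 ^ (G.1 - I.card) else 0)
          else 0) ≤ (0 : ℕ)} := by
      rw [Set.mem_setOf_eq, decode_junk]
    simp only [Ensemble.prob, PMF.toOuterMeasure_pure_apply, hmem, if_true]
    simp

end

end Summit.PneNP.PneNP.Theorems.PseudorandomTwinsAbove.Negative
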